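import Summits.KontsevichZagierPeriods.KontsevichZagierPeriods.Theorems.HeckeMultiplicityOneModularSectorCommensurabilityPrep
import Literature.NumberTheory.EllipticCurves.ModularSymbolRep
import Literature.NumberTheory.EllipticCurves.ModularSymbolsManin

/-!
# `ModularSectorCommensurability` (stmt-KontsevichZagierPeriods-5195, route `HeckeMultiplicityOne`) — the class map on Manin symbols and the glue of the sector theorem

Helper file for the (still informal) support item stmt-KontsevichZagierPeriods-5195
`ModularSectorCommensurability` of route `KontsevichZagierPeriods/HeckeMultiplicityOne` (the modular
sector of Kontsevich–Zagier's Conjecture 1: any two modular-symbol representations — real parts, resp.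
imaginary parts — of one rational newform `f ∈ S₂(Γ₀(N))` are `ℤ`-commensurable modulo the moves).
The representations are those of `Literature/NumberTheory/EllipticCurves/ModularSymbolRep`: for
`ρ : ModularSymbolRep f g` the classes `ρ.classRe`, `ρ.classIm ∈ KZ.FormalRep` of `re ⟨g⟩_f`,
`im ⟨g⟩_f`, `⟨g⟩_f = 2πi ∫_{g0}^{g∞} f(z) dz`.

What is proved here (everything that the route's mechanism asks of the OBJECTS, as opposed to the
two analytic inputs `HeckeIsMoves` and `ManinStokes`, which enter as hypotheses):
* the real involution `g ↦ g^ε = JgJ` (`reflect`) is an automorphism of `SL(2, ℤ)` preserving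
  `Γ₀(N)`, hence a permutation of the Manin symbols `SL(2, ℤ) ⧸ Γ₀(N)` (`exists_perm_reflect`);
* the classes `[re ⟨g⟩_f]`, `[im ⟨g⟩_f]` are literally equal for `g`, `g'` in the same coset
  `Γ₀(N) g` and for `±g` (`classRe_eq_of_mul_inv_mem`, `classRe_neg`, …), so that the **class map**
  `Λ : ℤ^{SL(2,ℤ)⧸Γ₀(N)} →+ FormalRep`, `e_{[g]} ↦ [re ⟨g⁻¹⟩_f]` (resp. `im`) exists
  (`exists_classMap_re`, `exists_classMap_im`; the coset `gΓ₀(N)` carries the symbol of `g⁻¹`, the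
  convention of `ModularSymbolsManin.msymbol`);
* the generator relations of Manin's presentation and of the involution for `Λ` modulo
  `KZ.relations`: two-term (holds identically, `classMap_re_two_term`), three-term from the
  three-term relation of the symbols by moves (`classMap_re_three_term`, hypothesis `ManinStokes`),
  parity (`classMap_re_reflect`: real parts even, `classMap_im_reflect`: imaginary parts odd — by
  integrand additivity, `ModularSymbolRep.classRe_reflect_sub_mem_relations`);
* **the glue** `classRe_commensurable`, `classIm_commensurable`: `HeckeIsMoves` (integer matrices
  `H_j` on the Manin symbols with `Λ (H_j m) - a_j Λ m ∈ KZ.relations`) + `ManinStokes` +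
  multiplicity one (any two rational vectors on the Manin symbols killing the two- and three-term
  relations, of the right parity, and joint row-eigenvectors of the `H_j`, are proportional) ⟹
  `(c, c') ≠ (0, 0)` with `c • [re ⟨g⟩_f] - c' • [re ⟨g'⟩_f] ∈ KZ.relations` for all `g, g'`, by
  `commensurable_of_perm_relations` of the `…Prep` file (the landed `MultiplicityOneAlgebra`).

With `H_j` Merel's Heilbronn matrices of `T_p` (`p ∤ N`, `a_j = a_p(f) ∈ ℤ`) the multiplicity-one
hypothesis says that the `(f, ±)`-eigenspace in the dual of the Manin-symbol module
`ℚ^{ℙ¹(ℤ/N)}/(2-, 3-term)` `≅ H₁(X₀(N), cusps; ℚ)` (Manin 1972, Thm. 1.9) is a line (Eichler–Shimura,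
Atkin–Lehner, Merel 1994 Thm. 2; Cremona 1997 §2.8) — a Literature fact to be filed with the typed
`HeckeIsMoves` / `ManinStokes`; nothing here depends on that choice.

References: Ju. I. Manin, *Parabolic points and zeta functions of modular curves* (1972), §1.5–1.7,
Thm. 1.9; J. E. Cremona, *Algorithms for modular elliptic curves* (1997), §2.1–2.2, §2.8; L. Merel,
*Universal Fourier expansions of modular forms* (1994), Thm. 2; B. Mazur, P. Swinnerton-Dyer, *Arithmetic
of Weil curves* (1974), §2; M. Kontsevich, D. Zagier, *Periods* (2001), §1.2, §3.4.
-/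

open scoped MatrixGroups ModularForm Classical
open CongruenceSubgroup ModularGroup

namespace Summit.KontsevichZagierPeriods.HeckeMultiplicityOne.ModularSectorCommensurability

open Literature.NumberTheory.EllipticCurves.ModularForms
open Literature.NumberTheory.Transcendental

/-! ### The reflection `g ↦ g^ε = JgJ` is an automorphism of `SL(2, ℤ)` preserving `Γ₀(N)` -/
/-- `reflect` is multiplicative: `J(gh)J = (JgJ)(JhJ)`. [folklore] -/
theorem reflect_mul (g h : SL(2, ℤ)) : reflect (g * h) = reflect g * reflect h := by
  ext i j
  fin_cases i <;> fin_cases j <;>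
    simp [Matrix.SpecialLinearGroup.coe_mul, Matrix.mul_apply, Fin.sum_univ_two] <;> ring

/-- `reflect 1 = 1`. [folklore] -/
theorem reflect_one : reflect (1 : SL(2, ℤ)) = 1 := by
  ext i j; fin_cases i <;> fin_cases j <;> simp [Matrix.SpecialLinearGroup.coe_one]

/-- `reflect` commutes with inversion. [folklore] -/
theorem reflect_inv (g : SL(2, ℤ)) : reflect g⁻¹ = (reflect g)⁻¹ :=
  eq_inv_of_mul_eq_one_left (by rw [← reflect_mul, inv_mul_cancel, reflect_one])

/-- `reflect` preserves `Γ₀(N)` (the lower-left entry changes sign). [folklore] -/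
theorem reflect_mem_Gamma0 (N : ℕ) (γ : SL(2, ℤ)) : reflect γ ∈ Gamma0 N ↔ γ ∈ Gamma0 N := by
  rw [Gamma0_mem, Gamma0_mem, reflect_apply_10, Int.cast_neg, neg_eq_zero]

/-- **The real involution on the Manin symbols**: `reflect` descends to a permutation `r` of
`SL(2, ℤ) ⧸ Γ₀(N)` with `r [g] = [g^ε]`. [cite: CremonaAlgorithms1997, §2.1 (z ↦ z* = -z̄, γ̃ = JγJ)] -/
theorem exists_perm_reflect (N : ℕ) :
    ∃ r : Equiv.Perm (Gamma0Coset N), ∀ g : SL(2, ℤ),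
      r (g : Gamma0Coset N) = ((reflect g : SL(2, ℤ)) : Gamma0Coset N) := by
  have hinv : Function.Involutive (reflect : SL(2, ℤ) → SL(2, ℤ)) := reflect_reflect
  refine ⟨Quotient.congr (ra := QuotientGroup.leftRel (Gamma0 N))
      (rb := QuotientGroup.leftRel (Gamma0 N)) (hinv.toPerm _) fun a b => ?_,
    fun g => Quotient.congr_mk _ _ g⟩
  rw [QuotientGroup.leftRel_apply, QuotientGroup.leftRel_apply]
  show a⁻¹ * b ∈ Gamma0 N ↔ (reflect a)⁻¹ * reflect b ∈ Gamma0 N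
  rw [← reflect_inv, ← reflect_mul, reflect_mem_Gamma0]

/-! ### The classes `[re ⟨g⟩_f]`, `[im ⟨g⟩_f]` only depend on the Manin symbol `Γ₀(N) g` -/
section Classes

variable {N : ℕ} {f : CuspForm (Gamma0 N) 2}

/-- `f ∣ g' = f ∣ g` when `g' g⁻¹ ∈ Γ₀(N)` (`f` is `Γ₀(N)`-invariant). [folklore] -/
theorem slash_eq_of_mul_inv_mem {g g' : SL(2, ℤ)} (h : g' * g⁻¹ ∈ Gamma0 N) :
    ⇑f ∣[(2 : ℤ)] g' = ⇑f ∣[(2 : ℤ)] g := by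
  have e : g' = ((⟨g' * g⁻¹, h⟩ : Gamma0 N) : SL(2, ℤ)) * g := by
    simp
  calc ⇑f ∣[(2 : ℤ)] g' = (⇑f ∣[(2 : ℤ)] ((⟨g' * g⁻¹, h⟩ : Gamma0 N) : SL(2, ℤ))) ∣[(2 : ℤ)] g := by
        conv_lhs => rw [e]
        exact SlashAction.slash_mul _ _ _ _
    _ = ⇑f ∣[(2 : ℤ)] g := by rw [slash_Gamma0]

/-- `f ∣ (g' S) = f ∣ (g S)` when `g' g⁻¹ ∈ Γ₀(N)`. [folklore] -/
theorem slash_mul_S_eq_of_mul_inv_mem {g g' : SL(2, ℤ)} (h : g' * g⁻¹ ∈ Gamma0 N) :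
    ⇑f ∣[(2 : ℤ)] (g' * S) = ⇑f ∣[(2 : ℤ)] (g * S) :=
  slash_eq_of_mul_inv_mem (by simpa [mul_inv_rev, mul_assoc] using h)

/-- Admissibility of the canonical representation only depends on the Manin symbol `Γ₀(N) g`.
[folklore] -/
theorem modularSymbolRep_of_mul_inv_mem {g g' : SL(2, ℤ)} (h : g' * g⁻¹ ∈ Gamma0 N)
    (ρ : ModularSymbolRep f g) : ModularSymbolRep f g' :=
  ⟨by rw [slash_eq_of_mul_inv_mem h]; exact ρ.upper,
   by rw [slash_mul_S_eq_of_mul_inv_mem h]; exact ρ.lower⟩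

/-- **`[re ⟨g'⟩_f] = [re ⟨g⟩_f]` identically when `Γ₀(N) g' = Γ₀(N) g`** (same integrands).
[cite: CremonaAlgorithms1997, §2.2 Prop. 2.2.2] -/
theorem classRe_eq_of_mul_inv_mem {g g' : SL(2, ℤ)} (h : g' * g⁻¹ ∈ Gamma0 N)
    (ρ : ModularSymbolRep f g) (ρ' : ModularSymbolRep f g') : ρ'.classRe = ρ.classRe := by
  simp only [ModularSymbolRep.classRe]
  rw [halfArcRepRe_congr (slash_eq_of_mul_inv_mem h) ρ'.upper ρ.upper,
    halfArcRepRe_congr (slash_mul_S_eq_of_mul_inv_mem h) ρ'.lower ρ.lower]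

/-- **`[im ⟨g'⟩_f] = [im ⟨g⟩_f]` identically when `Γ₀(N) g' = Γ₀(N) g`.**
[cite: CremonaAlgorithms1997, §2.2 Prop. 2.2.2] -/
theorem classIm_eq_of_mul_inv_mem {g g' : SL(2, ℤ)} (h : g' * g⁻¹ ∈ Gamma0 N)
    (ρ : ModularSymbolRep f g) (ρ' : ModularSymbolRep f g') : ρ'.classIm = ρ.classIm := by
  simp only [ModularSymbolRep.classIm]
  rw [halfArcRepIm_congr (slash_eq_of_mul_inv_mem h) ρ'.upper ρ.upper,
    halfArcRepIm_congr (slash_mul_S_eq_of_mul_inv_mem h) ρ'.lower ρ.lower]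

/-- `(-g) g⁻¹ = -1 ∈ Γ₀(N)`. [folklore] -/
theorem neg_mul_inv_mem (g : SL(2, ℤ)) : -g * g⁻¹ ∈ Gamma0 N := by
  rw [neg_mul, mul_inv_cancel, Gamma0_mem]
  simp

/-- `[re ⟨-g⟩_f] = [re ⟨g⟩_f]`. [folklore] -/
theorem classRe_neg {g : SL(2, ℤ)} (ρ : ModularSymbolRep f g) (ρ' : ModularSymbolRep f (-g)) :
    ρ'.classRe = ρ.classRe :=
  classRe_eq_of_mul_inv_mem (neg_mul_inv_mem g) ρ ρ'

/-- `[im ⟨-g⟩_f] = [im ⟨g⟩_f]`. [folklore] -/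
theorem classIm_neg {g : SL(2, ℤ)} (ρ : ModularSymbolRep f g) (ρ' : ModularSymbolRep f (-g)) :
    ρ'.classIm = ρ.classIm :=
  classIm_eq_of_mul_inv_mem (neg_mul_inv_mem g) ρ ρ'

/-- **The class map on Manin symbols (real parts).** For a family of admissible canonical
representations `ρ g : ModularSymbolRep f g` there is an additive `Λ : ℤ^{SL(2,ℤ)⧸Γ₀(N)} →+ FormalRep`
with `Λ e_{[g]} = [re ⟨g⁻¹⟩_f]` (the coset `gΓ₀(N)` carries the Manin symbol of `g⁻¹`, as in
`ModularSymbolsManin.msymbol`). [cite: CremonaAlgorithms1997, §2.2 Prop. 2.2.2] -/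
theorem exists_classMap_re [NeZero N] (ρ : ∀ g : SL(2, ℤ), ModularSymbolRep f g) :
    ∃ Λ : (Gamma0Coset N → ℤ) →+ KZ.FormalRep,
      ∀ g : SL(2, ℤ), Λ (Pi.single (g : Gamma0Coset N) 1) = (ρ g⁻¹).classRe := by
  let L : Gamma0Coset N → KZ.FormalRep := fun q => (ρ q.out⁻¹).classRe
  have hL : ∀ g : SL(2, ℤ), L (g : Gamma0Coset N) = (ρ g⁻¹).classRe := by
    intro g
    obtain ⟨γ, hγ⟩ := QuotientGroup.mk_out_eq_mul (Gamma0 N) g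
    simp only [L]
    rw [hγ]
    refine classRe_eq_of_mul_inv_mem ?_ (ρ g⁻¹) (ρ _)
    rw [mul_inv_rev, inv_inv, mul_assoc, inv_mul_cancel, mul_one]
    exact inv_mem γ.2
  refine ⟨{ toFun := fun m => ∑ q, m q • L q
            map_zero' := by simp
            map_add' := fun m m' => by
              simp only [Pi.add_apply, add_smul, Finset.sum_add_distrib] }, fun g => ?_⟩
  simp only [AddMonoidHom.coe_mk, ZeroHom.coe_mk, Pi.single_apply, ite_smul, one_smul, zero_smul,
    Finset.sum_ite_eq', Finset.mem_univ, if_true]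
  exact hL g

/-- **The class map on Manin symbols (imaginary parts)**: `Λ e_{[g]} = [im ⟨g⁻¹⟩_f]`.
[cite: CremonaAlgorithms1997, §2.2 Prop. 2.2.2] -/
theorem exists_classMap_im [NeZero N] (ρ : ∀ g : SL(2, ℤ), ModularSymbolRep f g) :
    ∃ Λ : (Gamma0Coset N → ℤ) →+ KZ.FormalRep,
      ∀ g : SL(2, ℤ), Λ (Pi.single (g : Gamma0Coset N) 1) = (ρ g⁻¹).classIm := by
  let L : Gamma0Coset N → KZ.FormalRep := fun q => (ρ q.out⁻¹).classIm
  have hL : ∀ g : SL(2, ℤ), L (g : Gamma0Coset N) = (ρ g⁻¹).classIm := by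
    intro g
    obtain ⟨γ, hγ⟩ := QuotientGroup.mk_out_eq_mul (Gamma0 N) g
    simp only [L]
    rw [hγ]
    refine classIm_eq_of_mul_inv_mem ?_ (ρ g⁻¹) (ρ _)
    rw [mul_inv_rev, inv_inv, mul_assoc, inv_mul_cancel, mul_one]
    exact inv_mem γ.2
  refine ⟨{ toFun := fun m => ∑ q, m q • L q
            map_zero' := by simp
            map_add' := fun m m' => by
              simp only [Pi.add_apply, add_smul, Finset.sum_add_distrib] }, fun g => ?_⟩
  simp only [AddMonoidHom.coe_mk, ZeroHom.coe_mk, Pi.single_apply, ite_smul, one_smul, zero_smul,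
    Finset.sum_ite_eq', Finset.mem_univ, if_true]
  exact hL g

end Classes


/-! ### The generator relations of Manin's presentation and of the real involution, modulo moves -/
section Glue

variable {N : ℕ} {f : CuspForm (Gamma0 N) 2}

/-- **Two-term relation for the class map (real parts)**: `Λ e_q + Λ e_{Sq} ∈ KZ.relations`
(indeed `= 0`: `[re ⟨k⟩] + [re ⟨kS⟩] = 0` identically, `classRe_add_classRe_mul_S`).
[cite: CremonaAlgorithms1997, §2.1 (2.1.4)] -/
theorem classMap_re_two_term (ρ : ∀ g : SL(2, ℤ), ModularSymbolRep f g)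
    (Λ : (Gamma0Coset N → ℤ) →+ KZ.FormalRep)
    (hΛ : ∀ g : SL(2, ℤ), Λ (Pi.single (g : Gamma0Coset N) 1) = (ρ g⁻¹).classRe)
    (q : Gamma0Coset N) :
    Λ (Pi.single q 1) + Λ (Pi.single (S • q) 1) ∈ KZ.relations := by
  induction q using QuotientGroup.induction_on with
  | H k =>
    rw [MulAction.Quotient.smul_mk, smul_eq_mul, hΛ, hΛ, mul_inv_rev, ModularGroup.S_inv, mul_neg,
      classRe_neg (ρ (k⁻¹ * S)) (ρ (-(k⁻¹ * S))), ModularSymbolRep.classRe_add_classRe_mul_S]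
    exact KZ.relations.zero_mem

/-- **Two-term relation for the class map (imaginary parts)**. [cite: CremonaAlgorithms1997, §2.1 (2.1.4)] -/
theorem classMap_im_two_term (ρ : ∀ g : SL(2, ℤ), ModularSymbolRep f g)
    (Λ : (Gamma0Coset N → ℤ) →+ KZ.FormalRep)
    (hΛ : ∀ g : SL(2, ℤ), Λ (Pi.single (g : Gamma0Coset N) 1) = (ρ g⁻¹).classIm)
    (q : Gamma0Coset N) :
    Λ (Pi.single q 1) + Λ (Pi.single (S • q) 1) ∈ KZ.relations := by
  induction q using QuotientGroup.induction_on with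
  | H k =>
    rw [MulAction.Quotient.smul_mk, smul_eq_mul, hΛ, hΛ, mul_inv_rev, ModularGroup.S_inv, mul_neg,
      classIm_neg (ρ (k⁻¹ * S)) (ρ (-(k⁻¹ * S))), ModularSymbolRep.classIm_add_classIm_mul_S]
    exact KZ.relations.zero_mem

/-- `(TS)⁻¹ = -(TS)²` and `(TS)⁻² = -TS` in `SL(2, ℤ)` (`(TS)³ = -1`). [folklore] -/
theorem TS_inv_eq : (T * S)⁻¹ = -((T * S) ^ 2) ∧ (T * S)⁻¹ * (T * S)⁻¹ = -(T * S) := by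
  have h3 := TS_pow_three_eq
  constructor
  · apply inv_eq_of_mul_eq_one_right
    rw [mul_neg, pow_two, ← mul_assoc, h3, neg_neg]
  · rw [← mul_inv_rev]
    apply inv_eq_of_mul_eq_one_right
    rw [mul_neg, h3, neg_neg]

/-- **Three-term relation for the class map (real parts)** from the three-term relation of the
symbols modulo moves (`ManinStokes`: `[re ⟨g⟩] + [re ⟨gTS⟩] + [re ⟨g(TS)²⟩] ∈ KZ.relations`):
`Λ e_q + Λ e_{TS q} + Λ e_{(TS)² q} ∈ KZ.relations`. [cite: CremonaAlgorithms1997, §2.1 (2.1.4)] -/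
theorem classMap_re_three_term (ρ : ∀ g : SL(2, ℤ), ModularSymbolRep f g)
    (Λ : (Gamma0Coset N → ℤ) →+ KZ.FormalRep)
    (hΛ : ∀ g : SL(2, ℤ), Λ (Pi.single (g : Gamma0Coset N) 1) = (ρ g⁻¹).classRe)
    (hStokes : ∀ g : SL(2, ℤ),
      (ρ g).classRe + (ρ (g * (T * S))).classRe + (ρ (g * (T * S) ^ 2)).classRe ∈ KZ.relations)
    (q : Gamma0Coset N) :
    Λ (Pi.single q 1) + Λ (Pi.single ((T * S) • q) 1) + Λ (Pi.single ((T * S) • (T * S) • q) 1) ∈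
      KZ.relations := by
  induction q using QuotientGroup.induction_on with
  | H k =>
    rw [MulAction.Quotient.smul_mk, MulAction.Quotient.smul_mk, smul_eq_mul, smul_eq_mul, hΛ, hΛ, hΛ,
      mul_inv_rev (T * S) (T * S * k), mul_inv_rev (T * S) k, mul_assoc k⁻¹ (T * S)⁻¹ (T * S)⁻¹,
      TS_inv_eq.2, TS_inv_eq.1, mul_neg, mul_neg,
      classRe_neg (ρ (k⁻¹ * (T * S) ^ 2)) (ρ _), classRe_neg (ρ (k⁻¹ * (T * S))) (ρ _)]
    have := hStokes k⁻¹
    convert this using 1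
    abel

/-- **Three-term relation for the class map (imaginary parts).** [cite: CremonaAlgorithms1997, §2.1 (2.1.4)] -/
theorem classMap_im_three_term (ρ : ∀ g : SL(2, ℤ), ModularSymbolRep f g)
    (Λ : (Gamma0Coset N → ℤ) →+ KZ.FormalRep)
    (hΛ : ∀ g : SL(2, ℤ), Λ (Pi.single (g : Gamma0Coset N) 1) = (ρ g⁻¹).classIm)
    (hStokes : ∀ g : SL(2, ℤ),
      (ρ g).classIm + (ρ (g * (T * S))).classIm + (ρ (g * (T * S) ^ 2)).classIm ∈ KZ.relations)
    (q : Gamma0Coset N) :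
    Λ (Pi.single q 1) + Λ (Pi.single ((T * S) • q) 1) + Λ (Pi.single ((T * S) • (T * S) • q) 1) ∈
      KZ.relations := by
  induction q using QuotientGroup.induction_on with
  | H k =>
    rw [MulAction.Quotient.smul_mk, MulAction.Quotient.smul_mk, smul_eq_mul, smul_eq_mul, hΛ, hΛ, hΛ,
      mul_inv_rev (T * S) (T * S * k), mul_inv_rev (T * S) k, mul_assoc k⁻¹ (T * S)⁻¹ (T * S)⁻¹,
      TS_inv_eq.2, TS_inv_eq.1, mul_neg, mul_neg,
      classIm_neg (ρ (k⁻¹ * (T * S) ^ 2)) (ρ _), classIm_neg (ρ (k⁻¹ * (T * S))) (ρ _)]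
    have := hStokes k⁻¹
    convert this using 1
    abel

/-- **The real involution on the class map (real parts are even)**: `Λ e_{r q} - Λ e_q ∈ KZ.relations`
for `f` with real Fourier coefficients (`classRe_reflect_sub_mem_relations`).
[cite: CremonaAlgorithms1997, §2.1 (z ↦ z* = -z̄, γ̃ = JγJ) and §2.8] -/
theorem classMap_re_reflect [NeZero N]
    (hf : ∀ n, (starRingEnd ℂ) ((UpperHalfPlane.qExpansion 1 ⇑f).coeff n) = (UpperHalfPlane.qExpansion 1 ⇑f).coeff n)
    (ρ : ∀ g : SL(2, ℤ), ModularSymbolRep f g)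
    (Λ : (Gamma0Coset N → ℤ) →+ KZ.FormalRep)
    (hΛ : ∀ g : SL(2, ℤ), Λ (Pi.single (g : Gamma0Coset N) 1) = (ρ g⁻¹).classRe)
    (r : Equiv.Perm (Gamma0Coset N))
    (hr : ∀ g : SL(2, ℤ), r (g : Gamma0Coset N) = ((reflect g : SL(2, ℤ)) : Gamma0Coset N))
    (q : Gamma0Coset N) :
    Λ (Pi.single (r q) 1) - (1 : ℤ) • Λ (Pi.single q 1) ∈ KZ.relations := by
  induction q using QuotientGroup.induction_on with
  | H k =>
    rw [hr, hΛ, hΛ, one_smul, ← reflect_inv]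
    exact ModularSymbolRep.classRe_reflect_sub_mem_relations hf (ρ k⁻¹) (ρ (reflect k⁻¹))

/-- **The real involution on the class map (imaginary parts are odd)**:
`Λ e_{r q} + Λ e_q ∈ KZ.relations` (`classIm_reflect_add_mem_relations`).
[cite: CremonaAlgorithms1997, §2.1 (z ↦ z* = -z̄, γ̃ = JγJ) and §2.8] -/
theorem classMap_im_reflect [NeZero N]
    (hf : ∀ n, (starRingEnd ℂ) ((UpperHalfPlane.qExpansion 1 ⇑f).coeff n) = (UpperHalfPlane.qExpansion 1 ⇑f).coeff n)
    (ρ : ∀ g : SL(2, ℤ), ModularSymbolRep f g)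
    (Λ : (Gamma0Coset N → ℤ) →+ KZ.FormalRep)
    (hΛ : ∀ g : SL(2, ℤ), Λ (Pi.single (g : Gamma0Coset N) 1) = (ρ g⁻¹).classIm)
    (r : Equiv.Perm (Gamma0Coset N))
    (hr : ∀ g : SL(2, ℤ), r (g : Gamma0Coset N) = ((reflect g : SL(2, ℤ)) : Gamma0Coset N))
    (q : Gamma0Coset N) :
    Λ (Pi.single (r q) 1) - (-1 : ℤ) • Λ (Pi.single q 1) ∈ KZ.relations := by
  induction q using QuotientGroup.induction_on with
  | H k =>
    rw [hr, hΛ, hΛ, neg_one_zsmul, sub_neg_eq_add, ← reflect_inv]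
    exact ModularSymbolRep.classIm_reflect_add_mem_relations hf (ρ k⁻¹) (ρ (reflect k⁻¹))

/-! ### The glue of the sector theorem -/
/-- **Commensurability of the real parts of the modular symbols of one cusp form, from Hecke
equivariance by moves, the three-term relation by moves, and multiplicity one.**
Let `f ∈ S₂(Γ₀(N))` have real Fourier coefficients, let every unimodular symbol `⟨g⟩_f` admit its
canonical KZ representation (`ρ g`), and let `Λ` be the class map `e_{[g]} ↦ [re ⟨g⁻¹⟩_f]` on
`ℤ^{SL(2,ℤ)⧸Γ₀(N)}` (`exists_classMap_re`) and `r` the real involution on the cosets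
(`exists_perm_reflect`).  Assume
* (`HeckeIsMoves`, abstract form) integer matrices `H j` on the Manin symbols with integer
  eigenvalues `a j` such that `Λ (H j m) - a j • Λ m ∈ KZ.relations`;
* (`ManinStokes`) the three-term relation `[re ⟨g⟩] + [re ⟨gTS⟩] + [re ⟨g(TS)²⟩] ∈ KZ.relations`;
* (multiplicity one, plus part) any two rational vectors `φ` on the Manin symbols which kill the
  two- and three-term relations (`φ q + φ (Sq) = 0`, `φ q + φ (TSq) + φ ((TS)²q) = 0`), are even
  (`φ (r q) = φ q`) and are joint row-eigenvectors of the `H j` with eigenvalues `a j` are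
  `ℚ`-proportional.
Then for all `g, g' ∈ SL(2, ℤ)` there are `(c, c') ≠ (0, 0)` with
`c • [re ⟨g⟩_f] - c' • [re ⟨g'⟩_f] ∈ KZ.relations`.  (The two-term relation and the evenness of the
real parts hold by `ModularSymbolRep` alone; the proof is `commensurable_of_perm_relations`.)
[cite: MazurSwinnertonDyer1974, §2] [cite: CremonaAlgorithms1997, §2.1–2.2, §2.8] -/
theorem classRe_commensurable [NeZero N]
    (hf : ∀ n, (starRingEnd ℂ) ((UpperHalfPlane.qExpansion 1 ⇑f).coeff n) = (UpperHalfPlane.qExpansion 1 ⇑f).coeff n)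
    (ρ : ∀ g : SL(2, ℤ), ModularSymbolRep f g)
    (Λ : (Gamma0Coset N → ℤ) →+ KZ.FormalRep)
    (hΛ : ∀ g : SL(2, ℤ), Λ (Pi.single (g : Gamma0Coset N) 1) = (ρ g⁻¹).classRe)
    (r : Equiv.Perm (Gamma0Coset N))
    (hr : ∀ g : SL(2, ℤ), r (g : Gamma0Coset N) = ((reflect g : SL(2, ℤ)) : Gamma0Coset N))
    {J : Type*} (H : J → Matrix (Gamma0Coset N) (Gamma0Coset N) ℤ) (a : J → ℤ)
    (hHecke : ∀ (j : J) (m : Gamma0Coset N → ℤ), Λ ((H j).mulVec m) - a j • Λ m ∈ KZ.relations)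
    (hStokes : ∀ g : SL(2, ℤ),
      (ρ g).classRe + (ρ (g * (T * S))).classRe + (ρ (g * (T * S) ^ 2)).classRe ∈ KZ.relations)
    (hmult : ∀ φ ψ : Gamma0Coset N → ℚ,
      ((∀ q, φ q + φ (S • q) = 0) ∧ (∀ q, φ q + φ ((T * S) • q) + φ ((T * S) • (T * S) • q) = 0) ∧
        (∀ q, φ (r q) = φ q) ∧
        ∀ j, Matrix.vecMul φ ((H j).map (Int.cast : ℤ → ℚ)) = (a j : ℚ) • φ) →
      ((∀ q, ψ q + ψ (S • q) = 0) ∧ (∀ q, ψ q + ψ ((T * S) • q) + ψ ((T * S) • (T * S) • q) = 0) ∧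
        (∀ q, ψ (r q) = ψ q) ∧
        ∀ j, Matrix.vecMul ψ ((H j).map (Int.cast : ℤ → ℚ)) = (a j : ℚ) • ψ) →
      ∃ u v : ℚ, (u ≠ 0 ∨ v ≠ 0) ∧ u • φ = v • ψ)
    (g g' : SL(2, ℤ)) :
    ∃ c c' : ℤ, (c ≠ 0 ∨ c' ≠ 0) ∧ c • (ρ g).classRe - c' • (ρ g').classRe ∈ KZ.relations := by
  have h := commensurable_of_perm_relations KZ.relations H a
    (MulAction.toPerm (S : SL(2, ℤ))) (MulAction.toPerm (T * S : SL(2, ℤ))) r 1 Λ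
    (fun q => by simpa only [MulAction.toPerm_apply] using classMap_re_two_term ρ Λ hΛ q)
    (fun q => by
      simpa only [MulAction.toPerm_apply] using classMap_re_three_term ρ Λ hΛ hStokes q)
    (fun q => classMap_re_reflect hf ρ Λ hΛ r hr q) hHecke
    (fun φ ψ hφ hψ => hmult φ ψ
      (by simpa only [MulAction.toPerm_apply, Int.cast_one, one_mul] using hφ)
      (by simpa only [MulAction.toPerm_apply, Int.cast_one, one_mul] using hψ))
    (Pi.single ((g⁻¹ : SL(2, ℤ)) : Gamma0Coset N) 1) (Pi.single ((g'⁻¹ : SL(2, ℤ)) : Gamma0Coset N) 1)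
  rwa [hΛ, hΛ, inv_inv, inv_inv] at h

/-- **Commensurability of the imaginary parts** (odd under the real involution: `φ (r q) = -φ q`),
same mechanism with `ε = -1`. [cite: MazurSwinnertonDyer1974, §2] [cite: CremonaAlgorithms1997, §2.1–2.2, §2.8] -/
theorem classIm_commensurable [NeZero N]
    (hf : ∀ n, (starRingEnd ℂ) ((UpperHalfPlane.qExpansion 1 ⇑f).coeff n) = (UpperHalfPlane.qExpansion 1 ⇑f).coeff n)
    (ρ : ∀ g : SL(2, ℤ), ModularSymbolRep f g)
    (Λ : (Gamma0Coset N → ℤ) →+ KZ.FormalRep)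
    (hΛ : ∀ g : SL(2, ℤ), Λ (Pi.single (g : Gamma0Coset N) 1) = (ρ g⁻¹).classIm)
    (r : Equiv.Perm (Gamma0Coset N))
    (hr : ∀ g : SL(2, ℤ), r (g : Gamma0Coset N) = ((reflect g : SL(2, ℤ)) : Gamma0Coset N))
    {J : Type*} (H : J → Matrix (Gamma0Coset N) (Gamma0Coset N) ℤ) (a : J → ℤ)
    (hHecke : ∀ (j : J) (m : Gamma0Coset N → ℤ), Λ ((H j).mulVec m) - a j • Λ m ∈ KZ.relations)
    (hStokes : ∀ g : SL(2, ℤ),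
      (ρ g).classIm + (ρ (g * (T * S))).classIm + (ρ (g * (T * S) ^ 2)).classIm ∈ KZ.relations)
    (hmult : ∀ φ ψ : Gamma0Coset N → ℚ,
      ((∀ q, φ q + φ (S • q) = 0) ∧ (∀ q, φ q + φ ((T * S) • q) + φ ((T * S) • (T * S) • q) = 0) ∧
        (∀ q, φ (r q) = -φ q) ∧
        ∀ j, Matrix.vecMul φ ((H j).map (Int.cast : ℤ → ℚ)) = (a j : ℚ) • φ) →
      ((∀ q, ψ q + ψ (S • q) = 0) ∧ (∀ q, ψ q + ψ ((T * S) • q) + ψ ((T * S) • (T * S) • q) = 0) ∧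
        (∀ q, ψ (r q) = -ψ q) ∧
        ∀ j, Matrix.vecMul ψ ((H j).map (Int.cast : ℤ → ℚ)) = (a j : ℚ) • ψ) →
      ∃ u v : ℚ, (u ≠ 0 ∨ v ≠ 0) ∧ u • φ = v • ψ)
    (g g' : SL(2, ℤ)) :
    ∃ c c' : ℤ, (c ≠ 0 ∨ c' ≠ 0) ∧ c • (ρ g).classIm - c' • (ρ g').classIm ∈ KZ.relations := by
  have h := commensurable_of_perm_relations KZ.relations H a
    (MulAction.toPerm (S : SL(2, ℤ))) (MulAction.toPerm (T * S : SL(2, ℤ))) r (-1) Λ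
    (fun q => by simpa only [MulAction.toPerm_apply] using classMap_im_two_term ρ Λ hΛ q)
    (fun q => by
      simpa only [MulAction.toPerm_apply] using classMap_im_three_term ρ Λ hΛ hStokes q)
    (fun q => classMap_im_reflect hf ρ Λ hΛ r hr q) hHecke
    (fun φ ψ hφ hψ => hmult φ ψ
      (by simpa only [MulAction.toPerm_apply, Int.cast_neg, Int.cast_one, neg_one_mul] using hφ)
      (by simpa only [MulAction.toPerm_apply, Int.cast_neg, Int.cast_one, neg_one_mul] using hψ))
    (Pi.single ((g⁻¹ : SL(2, ℤ)) : Gamma0Coset N) 1) (Pi.single ((g'⁻¹ : SL(2, ℤ)) : Gamma0Coset N) 1)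
  rwa [hΛ, hΛ, inv_inv, inv_inv] at h

end Glue

end Summit.KontsevichZagierPeriods.HeckeMultiplicityOne.ModularSectorCommensurability
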